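import Mathlib
import Summits.NavierStokesRegularity.NavierStokesRegularity.Theses.EulerZoomLiouville
import Summits.NavierStokesRegularity.NavierStokesRegularity.Theorems.EulerZoomLiouvillePowerGaugeEulerLiouvilleLargeRho
import Summits.NavierStokesRegularity.NavierStokesRegularity.Theorems.EulerZoomLiouvillePowerGaugeEulerLiouvilleAllRhoStrata
import Literature.Analysis.FluidPDE.ClassicalSolution
import Literature.Analysis.FluidPDE.VectorCalculus
import Literature.Analysis.FluidPDE.Vorticity
import HarnessLib.Audit

/-!
# Line `vortex-volume` (ideator ns-idea-11 g0, lens «complete» = program-completion) for the crux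
# `EulerZoomLiouville.PowerGaugeEulerLiouville` (stmt-NavierStokesRegularity-19832)

PROGRAMME COMPLETED.  Chae's VORTEX-VOLUME programme — D. Chae, Comm. Math. Phys. 273 (2007) 203–215
doi:10.1007/s00220-007-0249-8 (no self-similar Euler blow-up when the profile vorticity lies in `∩_{0<q<q₀} L^q`: the `q ↓ 0` limit of
`‖Ω‖_q^q` is the MEASURE OF THE VORTICITY SUPPORT, conserved by the volume-preserving flow and incompatible with self-similar scaling);
D. Chae, T.-P. Tsai, Math. Res. Lett. 21 (2014) Thm 2.1 (discretely self-similar / time-periodic profile form) — uses the conserved vortex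
volume ONLY AGAINST A SCALING ANSATZ (exact or discrete self-similarity), and so does its in-tree completion by the lineage
(`…DSSVorticitySupport`: DSS + finite-measure support ⇒ trivial; `…ClassicalConcentrating`: support radius shrinking at the class rate
`(−τ)^{1/(2+ρ)}` via Kelvin far-field hypotheses ⇒ irrotational).  The author-named gap: «DSS members whose vorticity support has infinite
measure … and NON-self-similar members are untouched».  This line completes the vortex-volume programme OFF EVERY SCALING ANSATZ, for
arbitrary time dependence, inside Seregin's class.

THE LEVER (new on this crux): ENSTROPHY STARVATION × BIOT–SAVART VOLUME SLAVING.  Three facts, none of which sees vortex stretching: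
(1) REPRESENTATION — a classical member's slice with compactly supported vorticity IS its Biot–Savart field, `u(τ) = K₃ ∗ curl u(τ)`
    (the remainder is harmonic with sub-volume `L²` growth by the `A`-gauge, hence `0`);
(2) VOLUME SLAVING — Hardy–Littlewood–Sobolev + Hölder on the support: `∫|K₃ ∗ ω|² ≤ C · vol(supp ω)^{2/3} · ∫|ω|²`
    (energy is slaved to enstrophy THROUGH THE VORTEX VOLUME, and the vortex volume `vol{curl u(τ) ≠ 0}` is a Lagrangian invariant —
    stretching amplifies vorticity but cannot create vortex volume; in tree: `VorticitySupport.volume_vorticitySupport_eq_of_classical`);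
(3) STARVATION — the `E`-gauge `∫_{−b²}^{0}∫_{B(b)}|∇u|² ≤ c b^{1−ρ}` starves the enstrophy backward: by Chebyshev in time, on a set of
    times `τ' ∈ (−a², −a²/4)` of measure `≥ a²/2` one has `∫_{B(b)}|∇u(τ')|² ≤ 4c b^{1−ρ}/a²`, and if the vorticity support at those times
    sits inside `B(b)` with `b = a + κ(1+a²)^β`, then `∫|u(τ')|² ≤ 8C V₀^{2/3} c b^{1−ρ}/a² → 0` as `a → ∞` exactly when `β(1−ρ) < 1`.
So the far past is ENERGY-QUIESCENT on positive-measure time sets and the landed filler `ae_eq_zero_of_gauge_of_energyVanishing_allRho`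
(global energy of a member is a.e. non-increasing — no energy creation) gives `u ≡ 0`.
KILLED STRATUM (stubs V1, V1b, V2, V3; every `ρ ∈ (0, 1/2]`, indeed every `ρ > 0`): CLASSICAL members whose vorticity slices are supported in
balls `B(0, κ(1+|τ|)^β)` with `β(1−ρ) < 1` — this contains every classical member with compactly supported vorticity and BOUNDED VELOCITY
(`β = 1`: the support is transported), every compact-vorticity self-similar / DSS member (`β = 1/(2+ρ) < 1/2`, the lineage's scaling strata),
translating or tumbling vortex configurations of any time dependence, and even super-ballistic spreading `|τ|^{β}`, `1 < β < 1/(1−ρ)`.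
OPEN (declared, not claimed): V4 `stub_runawayVortexRest` (compact vorticity support escaping faster than every admissible power — thin) and
V5 `stub_diffuseVortexRest` (the residue: not classical, or vorticity support not compact — contains the algebraic-tail collapse candidates).
The composition is kernel-checked; sorries live only in `stub_*`.  No summit is proved by a line.
-/

noncomputable section

open MeasureTheory Set Filter Topology Metric
open scoped ENNReal NNReal
open Literature.Analysis Literature.Analysis.FluidPDE

set_option linter.dupNamespace false

namespace Summit.NavierStokesRegularity.NavierStokesRegularity.Cruxes.PowerGaugeEulerLiouville.VortexVolume

/-- Local abbreviation: ℝ³. -/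
abbrev E3 : Type := EuclideanSpace ℝ (Fin 3)

/-- Membership in Seregin's power-gauged ancient Euler class — verbatim the three hypotheses of the crux (same as `Birth.InClass`). -/
@[reducible] def InClass (ρ : ℝ) (u : ℝ → E3 → E3) (p : ℝ → E3 → ℝ) (H : ℝ → E3 → E3 →L[ℝ] E3)
    (c : ℝ≥0) : Prop :=
  IsSuitableWeakSolutionOn (slab (EuclideanSpace ℝ (Fin 3)) (Set.Iio 0) isOpen_Iio) 0 0 u p ∧
    HasWeakSpatialGradientOn (slab (EuclideanSpace ℝ (Fin 3)) (Set.Iio 0) isOpen_Iio) u H ∧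
    (∀ a : ℝ, 0 < a →
      ENNReal.ofReal (a ^ (2 * ρ)) * cknA a (0 : ℝ × E3) u + ENNReal.ofReal (a ^ ρ) * cknE a (0 : ℝ × E3) H +
        ENNReal.ofReal (a ^ (2 * ρ)) * cknD a (0 : ℝ × E3) p ≤ (c : ℝ≥0∞))

/-- The conclusion of the crux: `u` vanishes a.e. on the past slab. -/
@[reducible] def VanishesAE (u : ℝ → E3 → E3) : Prop :=
  Function.uncurry u =ᵐ[volume.restrict (Set.Iio (0 : ℝ) ×ˢ (Set.univ : Set E3))] 0

/-- COMPACT VORTEX: every past vorticity slice `curl u(τ)`, `τ < 0`, has compact support. -/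
def HasCompactVortex (u : ℝ → E3 → E3) : Prop :=
  ∀ τ : ℝ, τ < 0 → HasCompactSupport (curl (u τ))

/-- CONFINED VORTEX at exponent `ρ`: the vorticity slices are supported in the balls `B(0, κ(1+|τ|)^β)` for some `κ > 0` and some
`β ≥ 0` with `β(1−ρ) < 1` (for `0 < ρ ≤ 1/2` this allows every `β < 1/(1−ρ)`, in particular `β = 1` = transport by a bounded velocity
and `β = 1/(2+ρ)` = the class's self-similar spreading rate). -/
def IsConfinedVortex (ρ : ℝ) (u : ℝ → E3 → E3) : Prop :=
  ∃ κ β : ℝ, 0 < κ ∧ 0 ≤ β ∧ β * (1 - ρ) < 1 ∧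
    ∀ τ : ℝ, τ < 0 → Function.support (curl (u τ)) ⊆ Metric.ball (0 : E3) (κ * (1 + |τ|) ^ β)

/-- SLAB BOUNDS: velocity and velocity gradient are bounded on every compact past time interval (the hypothesis `hB` of the tree's
vortex-volume conservation `VorticitySupport.volume_vorticitySupport_eq_of_classical`). -/
def HasSlabBounds (u : ℝ → E3 → E3) : Prop :=
  ∀ s t : ℝ, s < t → t < 0 → ∃ B : ℝ, ∀ τ ∈ Set.Icc s t, ∀ y : E3, ‖u τ y‖ ≤ B ∧ ‖fderiv ℝ (u τ) y‖ ≤ B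

/-- THE VOLUME-SLAVING INEQUALITY (Hardy–Littlewood–Sobolev `I₁ : L^{6/5} → L²` + Hölder on the support): for a continuous compactly
supported vorticity, `∫ |K₃ ∗ ω|² ≤ C · vol(supp ω)^{2/3} · ∫ |ω|²` with a universal constant `C`. -/
def VortexVolumeEnergyIneq : Prop :=
  ∃ C : ℝ≥0, ∀ ω : E3 → E3, Continuous ω → HasCompactSupport ω →
    ∫⁻ x, ‖biotSavart ω x‖ₑ ^ 2 ≤ (C : ℝ≥0∞) * volume (Function.support ω) ^ (2 / 3 : ℝ) * ∫⁻ x, ‖ω x‖ₑ ^ 2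

/-! ## Registered stub signatures -/

/-- Signature of `stub_biotSavartSlice` (V1, size M, provable): a CLASSICAL member's slice with compactly supported vorticity is its own
Biot–Savart field.  (`curl u(τ)` is smooth, compactly supported and divergence free, so `K₃ ∗ curl u(τ)` is smooth, divergence free, in `L²`
(`eEnergy_biotSavart_lt_top`) with curl `curl u(τ)` (Majda–Bertozzi Prop. 2.16); the remainder `u(τ) − K₃ ∗ curl u(τ)` is curl- and
divergence-free, hence harmonic, with `∫_{B(a)}|·|² ≤ 2c a^{1−2ρ} + 2‖K₃ ∗ curl u(τ)‖₂² = o(a³)` by the `A`-gauge (every slice of a classical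
member, `a² > |τ|`), hence `0` by the harmonic Liouville theorem with growth, `Literature/…/HarmonicLiouvilleGrowth`.) -/
def Sig.stub_biotSavartSlice : Prop :=
  ∀ ρ : ℝ, 0 < ρ → ∀ (u : ℝ → E3 → E3) (p : ℝ → E3 → ℝ) (H : ℝ → E3 → E3 →L[ℝ] E3) (c : ℝ≥0),
    InClass ρ u p H c → IsClassicalEulerSolutionOn (Set.Iio 0) 0 u p →
      ∀ τ : ℝ, τ < 0 → HasCompactSupport (curl (u τ)) → u τ = biotSavart (curl (u τ))

/-- Signature of `stub_slabBounds` (V1b, size S/M, provable): a classical confined-vortex member represented by Biot–Savart has bounded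
velocity and velocity gradient on compact past time intervals (joint smoothness on `[s,t] × B̄(0, 2R̄)`, `R̄ = κ(1+|s|)^β`; outside, the
Biot–Savart integral over the common support ball `B(0, R̄)` and its derivative are bounded by `C · sup|curl u| · R̄³ / R̄²`, cf.
`norm_biotSavart_le_of_support_subset`, Majda–Bertozzi Lemma 4.5). -/
def Sig.stub_slabBounds : Prop :=
  ∀ ρ : ℝ, 0 < ρ → ∀ (u : ℝ → E3 → E3) (p : ℝ → E3 → ℝ) (H : ℝ → E3 → E3 →L[ℝ] E3) (c : ℝ≥0),
    InClass ρ u p H c → IsClassicalEulerSolutionOn (Set.Iio 0) 0 u p → IsConfinedVortex ρ u →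
      (∀ τ : ℝ, τ < 0 → u τ = biotSavart (curl (u τ))) → HasSlabBounds u

/-- Signature of `stub_vortexVolumeEnergy` (V2, size M, provable, pure harmonic analysis): the volume-slaving inequality
`‖K₃ ∗ ω‖₂² ≤ C vol(supp ω)^{2/3} ‖ω‖₂²` (`‖K₃ ∗ ω‖ ≤ (4π)⁻¹ I₁|ω|` pointwise, `enorm_biotSavart_le_rieszPotential`; HLS
`‖I₁ f‖₂ ≲ ‖f‖_{6/5}`, `Literature/Analysis/SingularIntegrals/HardyLittlewoodSobolev` (`lintegral_rieszPotential_rpow_le'`, `α = 1`,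
`p = 6/5`, `n = 3`); Hölder `‖ω‖_{6/5} ≤ vol(supp ω)^{1/3}‖ω‖₂`). -/
def Sig.stub_vortexVolumeEnergy : Prop :=
  VortexVolumeEnergyIneq

/-- Signature of `stub_starvedVortexEndgame` (V3, size M/L, provable — THE CORE): a classical confined-vortex member of the class,
represented by Biot–Savart, with slab bounds, and given the volume-slaving inequality, VANISHES.  (Vortex volume `V₀ = vol{curl u(τ) ≠ 0}`
is constant in `τ` (`VorticitySupport.volume_vorticitySupport_eq_of_classical`, hypotheses = slab bounds + the confinement ball); given
`ε, N`, take `a` large, `b = a + κ(1+a²)^β ≥ a`; the `E`-gauge at scale `b` (`setLIntegral_window_le_of_gaugeE`) and Chebyshev in time give a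
set of times `τ' ∈ (−a², −a²/4)` of measure `≥ a²/2` with `∫_{B(b)}|H(τ')|²_F ≤ 4c b^{1−ρ}/a²`; `H = ∇u` a.e.
(`hasWeakSpatialGradientOn_of_contDiffOn`, `HasWeakSpatialGradientOn.ae_eq`), `|curl|² ≤ 2|∇u|²_F`, the support sits in `B(b)`, so
`∫|u(τ')|² ≤ 8 C V₀^{2/3} c b^{1−ρ}/a² → 0` (`β(1−ρ) < 1`); hence the hypothesis of the landed filler
`Theorems.PowerGaugeEulerLiouville.ae_eq_zero_of_gauge_of_energyVanishing_allRho` holds and `u = 0` a.e.) -/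
def Sig.stub_starvedVortexEndgame : Prop :=
  ∀ ρ : ℝ, 0 < ρ → ∀ (u : ℝ → E3 → E3) (p : ℝ → E3 → ℝ) (H : ℝ → E3 → E3 →L[ℝ] E3) (c : ℝ≥0),
    InClass ρ u p H c → IsClassicalEulerSolutionOn (Set.Iio 0) 0 u p → IsConfinedVortex ρ u →
      (∀ τ : ℝ, τ < 0 → u τ = biotSavart (curl (u τ))) → HasSlabBounds u → VortexVolumeEnergyIneq → VanishesAE u

/-- Signature of `stub_runawayVortexRest` (V4, OPEN, thin — not claimed): classical members whose vorticity slices are compactly supported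
but NOT confined to balls of radius `κ(1+|τ|)^β` with `β(1−ρ) < 1` (support escaping to infinity backward faster than every admissible power,
or running off to infinity as `τ → 0⁻`) vanish.  For such members the velocity is unbounded on the support (else `β = 1`). -/
def Sig.stub_runawayVortexRest : Prop :=
  ∀ ρ : ℝ, 0 < ρ → ρ ≤ 1 / 2 → ∀ (u : ℝ → E3 → E3) (p : ℝ → E3 → ℝ) (H : ℝ → E3 → E3 →L[ℝ] E3) (c : ℝ≥0),
    InClass ρ u p H c → IsClassicalEulerSolutionOn (Set.Iio 0) 0 u p → HasCompactVortex u → ¬ IsConfinedVortex ρ u → VanishesAE u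

/-- Signature of `stub_diffuseVortexRest` (V5, OPEN residue — not claimed): members that are not classical, or some of whose vorticity
slices are not compactly supported (the natural collapse candidates with algebraic tails `|curl u| ~ |y|^{−2−ρ}` live here), vanish. -/
def Sig.stub_diffuseVortexRest : Prop :=
  ∀ ρ : ℝ, 0 < ρ → ρ ≤ 1 / 2 → ∀ (u : ℝ → E3 → E3) (p : ℝ → E3 → ℝ) (H : ℝ → E3 → E3 →L[ℝ] E3) (c : ℝ≥0),
    InClass ρ u p H c → ¬ (IsClassicalEulerSolutionOn (Set.Iio 0) 0 u p ∧ HasCompactVortex u) → VanishesAE u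

/-! ## Stubs (sorries live only here) -/

/-- STUB V1 [provable, M]: Biot–Savart representation of compact-vortex slices via the `A`-gauge harmonic Liouville theorem. -/
theorem stub_biotSavartSlice : Sig.stub_biotSavartSlice := by
  sorry

/-- STUB V1b [provable, S/M]: slab bounds for confined-vortex members from the representation. -/
theorem stub_slabBounds : Sig.stub_slabBounds := by
  sorry

/-- STUB V2 [provable, M]: the volume-slaving inequality (HLS + Hölder). -/
theorem stub_vortexVolumeEnergy : Sig.stub_vortexVolumeEnergy := by
  sorry

/-- STUB V3 [provable, M/L — THE CORE]: enstrophy starvation × volume slaving × energy monotonicity. -/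
theorem stub_starvedVortexEndgame : Sig.stub_starvedVortexEndgame := by
  sorry

/-- STUB V4 [OPEN, thin, not claimed]: runaway compact vortex supports. -/
theorem stub_runawayVortexRest : Sig.stub_runawayVortexRest := by
  sorry

/-- STUB V5 [OPEN residue, not claimed]: non-classical members / non-compact vorticity. -/
theorem stub_diffuseVortexRest : Sig.stub_diffuseVortexRest := by
  sorry

/-! ## Composition -/

/-- **Composition (kernel-checked, no sorry of its own): the six stubs (+ the landed large-`ρ` filler) give the crux BY NAME.** -/
theorem PowerGaugeEulerLiouville_of :
    Sig.stub_biotSavartSlice → Sig.stub_slabBounds → Sig.stub_vortexVolumeEnergy → Sig.stub_starvedVortexEndgame →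
      Sig.stub_runawayVortexRest → Sig.stub_diffuseVortexRest →
      Summit.NavierStokesRegularity.NavierStokesRegularity.Theses.EulerZoomLiouville.PowerGaugeEulerLiouville := by
  intro h1 h1b h2 h3 h4 h5 ρ hρ u p H c hsw hH hc
  by_cases hhalf : 1 / 2 < ρ
  · exact
      Summit.NavierStokesRegularity.NavierStokesRegularity.Theorems.PowerGaugeEulerLiouville.powerGaugeEulerLiouville_largeRho
        ρ hhalf u p H c hsw hH hc
  · have hρ2 : ρ ≤ 1 / 2 := not_lt.mp hhalf
    have hIn : InClass ρ u p H c := ⟨hsw, hH, hc⟩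
    by_cases hcv : IsClassicalEulerSolutionOn (Set.Iio 0) 0 u p ∧ HasCompactVortex u
    · by_cases hconf : IsConfinedVortex ρ u
      · have hrep : ∀ τ : ℝ, τ < 0 → u τ = biotSavart (curl (u τ)) :=
          fun τ hτ => h1 ρ hρ u p H c hIn hcv.1 τ hτ (hcv.2 τ hτ)
        exact h3 ρ hρ u p H c hIn hcv.1 hconf hrep (h1b ρ hρ u p H c hIn hcv.1 hconf hrep) h2
      · exact h4 ρ hρ hρ2 u p H c hIn hcv.1 hcv.2 hconf
    · exact h5 ρ hρ hρ2 u p H c hIn hcv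

end Summit.NavierStokesRegularity.NavierStokesRegularity.Cruxes.PowerGaugeEulerLiouville.VortexVolume
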